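import Literature.Geometry.GeometricMeasureTheory.SlabPushforward

/-!
# The graph homotopy current between a linear slice and its smooth perturbation

Let `ι : P →L[ℝ] V` be a continuous linear map from a finite-dimensional real normed space `P`
(Haar measure `μ`) and `u : P → V` a smooth compactly supported map. The **graph homotopy**
`Φ(t, x) = ι x + t · u x` joins `ι` to the graph map `Γ = ι + u` (it is the affine homotopy
`affineHomotopy ι (ι + u)` of `CurrentsProductBoundary.lean`, which treats general currents; the
present file is the explicit version for the slab current over `P`, with the integral formulas
needed to prove RECTIFIABILITY of the homotopy current in `HomotopyRectifiable.lean`). Pushing the slab current `⟦0,1⟧ × (μ ∧ e)`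
of `SlabCurrent.lean` forward by `Φ` (with a product cutoff that is invisible in all formulas)
gives, on any open `Ω' ⊆ V`, an `(n+1)`-current `S` (`exists_graphHomotopyCurrent`) with

* `S(φ) = ∫_{[0,1]} ∫_P φ(ι x + t u x)(u x, ι e₁ + t Du(x) e₁, …, ι eₙ + t Du(x) eₙ) dμ dt`;
* **homotopy formula** `∂S(φ) = ∫_P φ(ι x + u x)(ι eⱼ + Du(x) eⱼ)ⱼ dμ − ∫_P φ(ι x)(ι eⱼ)ⱼ dμ`
  for every test `n`-form `φ` with `φ ∘ ι = 0` off a given compact `K ⊆ P`;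
* `𝐌(S) ≤ ∫_{[0,1]} ∫_P ‖u x‖ ∏ⱼ ‖ι eⱼ + t Du(x) eⱼ‖ dμ dt`;
* `spt S ⊆ Φ([0,1] × spt u)`.

This is Federer's homotopy formula 4.1.9 for the graph (affine) homotopy between `ι_# (μ ∧ e)` and
`Γ_# (μ ∧ e)`, with the mass estimate of 4.1.9 (`‖h_#(⟦0,1⟧ × T)‖ ≤ ‖Γ − ι‖_∞ · …`).

## References

* H. Federer, *Geometric Measure Theory*, Springer 1969, 4.1.8–4.1.9 [Federer1969].
-/

noncomputable section

open scoped Topology ENNReal NNReal Distributions ContDiff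
open MeasureTheory TopologicalSpace Set Filter

namespace Literature.Geometry.GeometricMeasureTheory

-- Nested operator-norm instances on (duals of) `E [⋀^Fin m]→L[ℝ] ℝ`.
set_option maxSynthPendingDepth 2

variable {P : Type*} [NormedAddCommGroup P] [NormedSpace ℝ P] [FiniteDimensional ℝ P]
  [MeasurableSpace P] [BorelSpace P] (μ : Measure P) [μ.IsAddHaarMeasure]
  {V : Type*} [NormedAddCommGroup V] [NormedSpace ℝ V] {n : ℕ}

/-! ### The graph homotopy and its derivative -/

section Map

variable (ι : P →L[ℝ] V) (u : P → V)

/-- The graph homotopy `Φ(t, x) = ι x + t • u x` (`= affineHomotopy ι (ι + u)`). [cite: Federer1969, 4.1.9] -/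
def graphHomotopy : ℝ × P → V := fun z => ι z.2 + z.1 • u z.2

omit [FiniteDimensional ℝ P] [MeasurableSpace P] [BorelSpace P] in
/-- Unfolding `Φ(t, x) = ι x + t • u x`. [folklore] -/
@[simp] theorem graphHomotopy_apply (z : ℝ × P) : graphHomotopy ι u z = ι z.2 + z.1 • u z.2 :=
  rfl

variable {u}

omit [FiniteDimensional ℝ P] [MeasurableSpace P] [BorelSpace P] in
/-- `Φ` is smooth. [folklore] -/
theorem contDiff_graphHomotopy (hu : ContDiff ℝ ∞ u) : ContDiff ℝ ∞ (graphHomotopy ι u) :=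
  (ι.contDiff.comp contDiff_snd).add (contDiff_fst.smul (hu.comp contDiff_snd))

omit [FiniteDimensional ℝ P] [MeasurableSpace P] [BorelSpace P] in
/-- The derivative of `Φ`: `DΦ(t,x)(τ, w) = ι w + t • Du(x) w + τ • u x`. [folklore] -/
theorem hasFDerivAt_graphHomotopy (hu : ContDiff ℝ ∞ u) (z : ℝ × P) :
    HasFDerivAt (graphHomotopy ι u)
      (ι.comp (ContinuousLinearMap.snd ℝ ℝ P) +
        (z.1 • (fderiv ℝ u z.2).comp (ContinuousLinearMap.snd ℝ ℝ P) +
          (ContinuousLinearMap.fst ℝ ℝ P).smulRight (u z.2))) z := by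
  have h1 : HasFDerivAt (fun y : ℝ × P => ι y.2) (ι.comp (ContinuousLinearMap.snd ℝ ℝ P)) z :=
    ι.hasFDerivAt.comp z hasFDerivAt_snd
  have hu' : HasFDerivAt u (fderiv ℝ u z.2) z.2 :=
    ((hu.differentiable (by simp)).differentiableAt).hasFDerivAt
  have h2 : HasFDerivAt (fun y : ℝ × P => u y.2)
      ((fderiv ℝ u z.2).comp (ContinuousLinearMap.snd ℝ ℝ P)) z :=
    hu'.comp z hasFDerivAt_snd
  have h3 : HasFDerivAt (fun y : ℝ × P => y.1) (ContinuousLinearMap.fst ℝ ℝ P) z :=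
    hasFDerivAt_fst
  exact h1.add (h3.smul h2)

omit [FiniteDimensional ℝ P] [MeasurableSpace P] [BorelSpace P] in
/-- `DΦ(t,x)(1, 0) = u x`. [folklore] -/
theorem fderiv_graphHomotopy_inl (hu : ContDiff ℝ ∞ u) (z : ℝ × P) :
    fderiv ℝ (graphHomotopy ι u) z ((1 : ℝ), (0 : P)) = u z.2 := by
  rw [(hasFDerivAt_graphHomotopy ι hu z).fderiv]
  simp

omit [FiniteDimensional ℝ P] [MeasurableSpace P] [BorelSpace P] in
/-- `DΦ(t,x)(0, w) = ι w + t • Du(x) w`. [folklore] -/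
theorem fderiv_graphHomotopy_inr (hu : ContDiff ℝ ∞ u) (z : ℝ × P) (w : P) :
    fderiv ℝ (graphHomotopy ι u) z ((0 : ℝ), w) = ι w + z.1 • fderiv ℝ u z.2 w := by
  rw [(hasFDerivAt_graphHomotopy ι hu z).fderiv]
  simp

omit [FiniteDimensional ℝ P] [MeasurableSpace P] [BorelSpace P] in
/-- The push-forward frame `DΦ(z) ∘ slabFrame e = (u x, ι eⱼ + t Du(x) eⱼ)`. [folklore] -/
theorem fderiv_graphHomotopy_slabFrame (hu : ContDiff ℝ ∞ u) (e : Fin n → P) (z : ℝ × P) :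
    (fun i => fderiv ℝ (graphHomotopy ι u) z (slabFrame e i)) =
      Fin.cons (u z.2) fun j => ι (e j) + z.1 • fderiv ℝ u z.2 (e j) := by
  funext i
  refine Fin.cases ?_ (fun j => ?_) i
  · rw [slabFrame_zero, fderiv_graphHomotopy_inl ι hu, Fin.cons_zero]
  · rw [slabFrame_succ, fderiv_graphHomotopy_inr ι hu, Fin.cons_succ]

omit [FiniteDimensional ℝ P] [MeasurableSpace P] [BorelSpace P] in
/-- Off the support of `u` the homotopy is stationary: `Φ(t,x) = ι x`, `Du(x) = 0`.
[folklore] -/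
theorem fderiv_eq_zero_of_notMem_tsupport {x : P}
    (hx : x ∉ tsupport u) : u x = 0 ∧ fderiv ℝ u x = 0 := by
  refine ⟨image_eq_zero_of_notMem_tsupport hx, ?_⟩
  have h : u =ᶠ[𝓝 x] fun _ => 0 := notMem_tsupport_iff_eventuallyEq.1 hx
  rw [h.fderiv_eq]
  exact fderiv_const_apply (0 : V)

end Map

/-! ### Cutoffs and an integrability lemma -/

section Aux

omit [MeasurableSpace P] [BorelSpace P] [FiniteDimensional ℝ P] in
/-- A test function equal to `1` on an open set has zero derivative there. [folklore] -/
theorem fderiv_testFunction_eq_zero {E : Type*} [NormedAddCommGroup E] [NormedSpace ℝ E]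
    {Ω₀ : Opens E} (γ : 𝓓(Ω₀, ℝ)) {U : Set E} (hU : IsOpen U) (h1 : ∀ x ∈ U, γ x = 1) {x : E}
    (hx : x ∈ U) : fderiv ℝ (γ : E → ℝ) x = 0 := by
  have h : (γ : E → ℝ) =ᶠ[𝓝 x] fun _ => 1 := eventually_of_mem (hU.mem_nhds hx) h1
  rw [h.fderiv_eq]
  exact fderiv_const_apply (1 : ℝ)

/-- A continuous function on `ℝ × P` vanishing when the second coordinate leaves a compact set
is integrable for `(vol ⌞ [0,1]) × μ`. [folklore] -/
theorem integrable_prod_of_continuous_of_eq_zero {g : ℝ × P → ℝ} (hg : Continuous g) {L : Set P}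
    (hL : IsCompact L) (h0 : ∀ z : ℝ × P, z.2 ∉ L → g z = 0) :
    Integrable g (((volume : Measure ℝ).restrict (Icc 0 1)).prod μ) := by
  set ν : Measure (ℝ × P) := ((volume : Measure ℝ).restrict (Icc 0 1)).prod μ with hν
  -- a bound on the compact set `[0,1] × L`
  obtain ⟨M, hM⟩ : ∃ M, ∀ z ∈ Icc (0 : ℝ) 1 ×ˢ L, ‖g z‖ ≤ M := by
    have hc : IsCompact (Icc (0 : ℝ) 1 ×ˢ L) := isCompact_Icc.prod hL
    obtain ⟨M, hM⟩ := (hc.image (continuous_norm.comp hg)).isBounded.subset_closedBall 0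
    exact ⟨M, fun z hz => by simpa using hM ⟨z, hz, rfl⟩⟩
  have hLm : MeasurableSet L := hL.isClosed.measurableSet
  -- dominate by `max M 0 · 𝟙_{ℝ × L}`
  have hdom : Integrable (fun z : ℝ × P => (univ ×ˢ L).indicator (fun _ => max M 0) z) ν := by
    refine (integrable_indicator_iff (MeasurableSet.univ.prod hLm)).2 ?_
    refine integrableOn_const ?_
    rw [hν, Measure.prod_prod]
    exact ENNReal.mul_ne_top (by simp [Real.volume_Icc]) hL.measure_lt_top.ne
  refine hdom.mono' hg.aestronglyMeasurable ?_
  have hae : ∀ᵐ z ∂ν, z.1 ∈ Icc (0 : ℝ) 1 :=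
    (Measure.quasiMeasurePreserving_fst (μ := (volume : Measure ℝ).restrict (Icc 0 1))
      (ν := μ)).ae (ae_restrict_mem measurableSet_Icc)
  filter_upwards [hae] with z hz
  by_cases h : z.2 ∈ L
  · rw [indicator_of_mem (show z ∈ univ ×ˢ L from ⟨mem_univ _, h⟩)]
    exact (hM z ⟨hz, h⟩).trans (le_max_left _ _)
  · rw [h0 z h, norm_zero]
    exact indicator_nonneg (fun _ _ => le_max_right _ _) _

end Aux

/-! ### The homotopy current -/

section Current

variable (e : Fin n → P) (ι : P →L[ℝ] V) {u : P → V}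

/-- **The graph homotopy current** `S = Φ_#(⟦0,1⟧ × (μ ∧ e))`, `Φ(t,x) = ι x + t u x`, on an open
`Ω' ⊆ V`: its formula, the homotopy formula for `∂S` on test forms vanishing on `ι(P ∖ K)`, the
mass bound `𝐌(S) ≤ ∫_{[0,1]×P} ‖u‖ ∏ⱼ ‖ι eⱼ + t Du eⱼ‖`, and `spt S ⊆ Φ([0,1] × spt u)`.
[cite: Federer1969, 4.1.8–4.1.9] -/
theorem exists_graphHomotopyCurrent (hu : ContDiff ℝ ∞ u) (hus : HasCompactSupport u)
    {K : Set P} (hK : IsCompact K) (Ω' : Opens V) :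
    ∃ S : Current Ω' (n + 1),
      (∀ φ : TestForm Ω' (n + 1), S φ =
        ∫ z, φ (ι z.2 + z.1 • u z.2)
            (Fin.cons (u z.2) fun j => ι (e j) + z.1 • fderiv ℝ u z.2 (e j))
          ∂(((volume : Measure ℝ).restrict (Icc 0 1)).prod μ)) ∧
      (∀ φ : TestForm Ω' n, (∀ x, x ∉ K → φ (ι x) = 0) →
        S.boundary φ =
          (∫ x, φ (ι x + u x) (fun j => ι (e j) + fderiv ℝ u x (e j)) ∂μ) -
            ∫ x, φ (ι x) (fun j => ι (e j)) ∂μ) ∧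
      S.mass ≤ ENNReal.ofReal (∫ z, ‖u z.2‖ * ∏ j, ‖ι (e j) + z.1 • fderiv ℝ u z.2 (e j)‖
          ∂(((volume : Measure ℝ).restrict (Icc 0 1)).prod μ)) ∧
      S.support ⊆ graphHomotopy ι u '' (Icc (0 : ℝ) 1 ×ˢ tsupport u) := by
  set ν : Measure (ℝ × P) := ((volume : Measure ℝ).restrict (Icc 0 1)).prod μ with hν
  have hae : ∀ᵐ z ∂ν, z.1 ∈ Icc (0 : ℝ) 1 :=
    (Measure.quasiMeasurePreserving_fst (μ := (volume : Measure ℝ).restrict (Icc 0 1))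
      (ν := μ)).ae (ae_restrict_mem measurableSet_Icc)
  -- cutoffs: `α = 1` near `[0,1]`, `β = 1` near `K ∪ spt u`
  obtain ⟨α, Uα, hUα, hIU, hα1, -⟩ :=
    exists_testFunction_eq_one_nhds (Ω := (⊤ : Opens ℝ)) isCompact_Icc
      (subset_univ (Icc (0 : ℝ) 1))
  obtain ⟨β, Uβ, hUβ, hKU, hβ1, hβ01⟩ :=
    exists_testFunction_eq_one_nhds (Ω := (⊤ : Opens P)) (hK.union hus) (subset_univ _)
  have hχc : ContDiff ℝ ∞ fun z : ℝ × P => α z.1 * β z.2 :=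
    (α.contDiff.comp contDiff_fst).mul (β.contDiff.comp contDiff_snd)
  have hχs : HasCompactSupport fun z : ℝ × P => α z.1 * β z.2 := by
    refine HasCompactSupport.intro (α.hasCompactSupport.prod β.hasCompactSupport) ?_
    intro z hz
    rw [mem_prod, not_and_or] at hz
    rcases hz with h | h
    · rw [image_eq_zero_of_notMem_tsupport h, zero_mul]
    · rw [image_eq_zero_of_notMem_tsupport h, mul_zero]
  let χ : 𝓓((⊤ : Opens (ℝ × P)), ℝ) := ⟨fun z => α z.1 * β z.2, hχc, hχs, fun _ _ => trivial⟩
  have hχ : ∀ z : ℝ × P, χ z = α z.1 * β z.2 := fun z => rfl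
  -- facts about the cutoffs
  have hαt : ∀ t ∈ Icc (0 : ℝ) 1, α t = 1 := fun t ht => hα1 t (hIU ht)
  have hβx : ∀ x : P, β x ≠ 1 → x ∉ K ∧ u x = 0 ∧ fderiv ℝ u x = 0 := by
    intro x hx
    have hxU : x ∉ Uβ := fun h => hx (hβ1 x h)
    have hxK : x ∉ K := fun h => hxU (hKU (Or.inl h))
    have hxu : x ∉ tsupport u := fun h => hxU (hKU (Or.inr h))
    exact ⟨hxK, fderiv_eq_zero_of_notMem_tsupport hxu⟩
  have hχd : ∀ z : ℝ × P, HasFDerivAt (χ : ℝ × P → ℝ)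
      (α z.1 • (fderiv ℝ (β : P → ℝ) z.2).comp (ContinuousLinearMap.snd ℝ ℝ P) +
        β z.2 • (fderiv ℝ (α : ℝ → ℝ) z.1).comp (ContinuousLinearMap.fst ℝ ℝ P)) z := by
    intro z
    have ha : HasFDerivAt (fun y : ℝ × P => α y.1)
        ((fderiv ℝ (α : ℝ → ℝ) z.1).comp (ContinuousLinearMap.fst ℝ ℝ P)) z :=
      ((α.contDiff.differentiable (by simp)).differentiableAt.hasFDerivAt).comp z hasFDerivAt_fst
    have hb : HasFDerivAt (fun y : ℝ × P => β y.2)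
        ((fderiv ℝ (β : P → ℝ) z.2).comp (ContinuousLinearMap.snd ℝ ℝ P)) z :=
      ((β.contDiff.differentiable (by simp)).differentiableAt.hasFDerivAt).comp z hasFDerivAt_snd
    exact ha.mul hb
  set Φ := graphHomotopy ι u with hΦdef
  have hΦ : ContDiff ℝ ∞ Φ := contDiff_graphHomotopy ι hu
  have ht : ∀ z : ℝ × P, z.1 ∈ Icc (0 : ℝ) 1 →
      fderiv ℝ (χ : ℝ × P → ℝ) z ((1 : ℝ), (0 : P)) = 0 := by
    intro z hz
    rw [(hχd z).fderiv, fderiv_testFunction_eq_zero α hUα hα1 (hIU hz)]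
    simp
  have hx : ∀ z : ℝ × P, z.1 ∈ Icc (0 : ℝ) 1 →
      (∀ w : P, fderiv ℝ (χ : ℝ × P → ℝ) z ((0 : ℝ), w) = 0) ∨
        fderiv ℝ Φ z ((1 : ℝ), (0 : P)) = 0 := by
    intro z _
    by_cases hzU : z.2 ∈ Uβ
    · left
      intro w
      rw [(hχd z).fderiv, fderiv_testFunction_eq_zero β hUβ hβ1 hzU]
      simp
    · right
      have hzu : z.2 ∉ tsupport u := fun h => hzU (hKU (Or.inr h))
      rw [hΦdef, fderiv_graphHomotopy_inl ι hu]
      exact (fderiv_eq_zero_of_notMem_tsupport hzu).1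
  -- the frame integrand vanishes wherever `u` does
  have hframe0 : ∀ (ψ : Covector V (n + 1)) (z : ℝ × P), u z.2 = 0 →
      ψ (Fin.cons (u z.2) fun j => ι (e j) + z.1 • fderiv ℝ u z.2 (e j)) = 0 := by
    intro ψ z h0
    exact ψ.map_coord_zero 0 (by rw [Fin.cons_zero, h0])
  refine ⟨(slabCurrent μ ⊤ e).pushforward Ω' χ hΦ, ?_, ?_, ?_, ?_⟩
  · -- the formula
    intro φ
    rw [slabCurrent_pushforward_apply]
    refine integral_congr_ae ?_
    filter_upwards [hae] with z hz
    rw [fderiv_graphHomotopy_slabFrame ι hu e z, hχ, hαt z.1 hz, one_mul]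
    by_cases hb : β z.2 = 1
    · rw [hb, one_mul]
      rfl
    · obtain ⟨-, hu0, -⟩ := hβx z.2 hb
      rw [hframe0 _ z hu0, mul_zero]
      exact (hframe0 _ z hu0).symm
  · -- the homotopy formula
    intro φ hφK
    rw [slabCurrent_pushforward_boundary_apply μ e χ hΦ ht hx φ]
    have h1 : (1 : ℝ) ∈ Icc (0 : ℝ) 1 := ⟨zero_le_one, le_rfl⟩
    have h0 : (0 : ℝ) ∈ Icc (0 : ℝ) 1 := ⟨le_rfl, zero_le_one⟩
    congr 1
    · refine integral_congr_ae (Eventually.of_forall fun x => ?_)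
      simp only [hχ, hαt 1 h1, one_mul]
      have eΦ : Φ ((1 : ℝ), x) = ι x + u x := by simp [hΦdef]
      have eD : (fun j => fderiv ℝ Φ ((1 : ℝ), x) ((0 : ℝ), e j)) =
          fun j => ι (e j) + fderiv ℝ u x (e j) := by
        funext j
        rw [hΦdef, fderiv_graphHomotopy_inr ι hu, one_smul]
      rw [eΦ, eD]
      by_cases hb : β x = 1
      · rw [hb, one_mul]
      · obtain ⟨hxK, hu0, hDu⟩ := hβx x hb
        simp [hu0, hDu, hφK x hxK]
    · refine integral_congr_ae (Eventually.of_forall fun x => ?_)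
      simp only [hχ, hαt 0 h0, one_mul]
      have eΦ : Φ ((0 : ℝ), x) = ι x := by simp [hΦdef]
      have eD : (fun j => fderiv ℝ Φ ((0 : ℝ), x) ((0 : ℝ), e j)) = fun j => ι (e j) := by
        funext j
        rw [hΦdef, fderiv_graphHomotopy_inr ι hu, zero_smul, add_zero]
      rw [eΦ, eD]
      by_cases hb : β x = 1
      · rw [hb, one_mul]
      · obtain ⟨hxK, -, -⟩ := hβx x hb
        simp [hφK x hxK]
  · -- the mass bound
    refine (mass_slabCurrent_pushforward_le μ e χ hΦ).trans (ENNReal.ofReal_le_ofReal ?_)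
    have hgc : Continuous fun z : ℝ × P =>
        ‖u z.2‖ * ∏ j, ‖ι (e j) + z.1 • fderiv ℝ u z.2 (e j)‖ :=
      (hu.continuous.comp continuous_snd).norm.mul (continuous_finsetProd _ fun j _ =>
        (continuous_const.add (continuous_fst.smul
          (((hu.continuous_fderiv (by simp)).comp continuous_snd).clm_apply
            continuous_const))).norm)
    have hgi : Integrable (fun z : ℝ × P =>
        ‖u z.2‖ * ∏ j, ‖ι (e j) + z.1 • fderiv ℝ u z.2 (e j)‖) ν :=
      integrable_prod_of_continuous_of_eq_zero μ hgc hus fun z hz => by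
        rw [image_eq_zero_of_notMem_tsupport hz, norm_zero, zero_mul]
    refine integral_mono_of_nonneg ?_ hgi ?_
    · exact Eventually.of_forall fun z => mul_nonneg (abs_nonneg _)
        (Finset.prod_nonneg fun i _ => norm_nonneg _)
    · filter_upwards [hae] with z hz
      rw [Fin.prod_univ_succ, slabFrame_zero, hΦdef, fderiv_graphHomotopy_inl ι hu, hχ,
        hαt z.1 hz, one_mul]
      simp only [slabFrame_succ, fderiv_graphHomotopy_inr ι hu]
      have hb1 : |β z.2| ≤ 1 := abs_le.2 ⟨by linarith [(hβ01 z.2).1], (hβ01 z.2).2⟩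
      calc |β z.2| * (‖u z.2‖ * ∏ j, ‖ι (e j) + z.1 • fderiv ℝ u z.2 (e j)‖)
          ≤ 1 * (‖u z.2‖ * ∏ j, ‖ι (e j) + z.1 • fderiv ℝ u z.2 (e j)‖) :=
            mul_le_mul_of_nonneg_right hb1 (mul_nonneg (norm_nonneg _)
              (Finset.prod_nonneg fun i _ => norm_nonneg _))
        _ = _ := one_mul _
  · -- the support
    intro y hy
    by_contra hyc
    have hcl : IsClosed (Φ '' (Icc (0 : ℝ) 1 ×ˢ tsupport u)) :=
      ((isCompact_Icc.prod hus).image hΦ.continuous).isClosed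
    obtain ⟨φ, hφU, hφT⟩ := hy.2 _ (hcl.isOpen_compl.mem_nhds hyc)
    refine hφT ?_
    rw [slabCurrent_pushforward_apply]
    refine integral_eq_zero_of_ae ?_
    filter_upwards [hae] with z hz
    rw [Pi.zero_apply, fderiv_graphHomotopy_slabFrame ι hu e z]
    by_cases hzu : z.2 ∈ tsupport u
    · have hmem : Φ z ∈ Φ '' (Icc (0 : ℝ) 1 ×ˢ tsupport u) := ⟨z, ⟨hz, hzu⟩, rfl⟩
      have : φ (Φ z) = 0 := image_eq_zero_of_notMem_tsupport fun h => hφU h hmem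
      rw [this]
      simp
    · rw [hframe0 _ z (image_eq_zero_of_notMem_tsupport hzu), mul_zero]

end Current

end Literature.Geometry.GeometricMeasureTheory
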